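import Summits.PneNP.PneNP.Theses.ExpanderLinearGenerators
import Literature.Computability.MetaComplexity.LinearMapResolutionWidthProofs

/-!
# PneNP / ExpanderLinearGenerators — `ExpansionForcesDepthFregeSize` at locality `ℓ ≤ 7`
(stmt-PneNP-11442, helper file)

Route `PneNP/ExpanderLinearGenerators`, support item stmt-PneNP-11442
(`Summit.PneNP.PneNP.Theses.ExpanderLinearGenerators.ExpansionForcesDepthFregeSize`, the
"expansion-scale law": for every locality `ℓ ≥ 1` and depth `d` there are `ε > 0` and `R` such that
for `r ≥ R` every unsolvable `ℓ`-sparse system over `𝔽₂` whose row supports form an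
`(r, 3/4 · ℓ)`-boundary expander forces depth-`d` `textbookFrege` refutations of size `≥ 2^(r^ε)`).

This file settles the law at every locality `ℓ ≤ 7`, where it holds for a combinatorial reason the
item's authors did not anticipate: **at unique-neighbour expansion `3/4 · ℓ` with `ℓ ≤ 7`, no
unsolvable expanding system exists once `r ≥ 1 + ℓ + ℓ²`**, so the conclusion is vacuous.

* `exists_partner_of_boundary_eq_empty` — in a row set `F` with empty boundary every point of a
  row of `F` lies in a second row of `F`.
* `boundary_nonempty_of_isBoundaryExpander_of_le_seven` — the combinatorial heart. If the scopes
  have `≤ ℓ` points, `1 ≤ ℓ ≤ 7`, and form an `(r, 3ℓ/4)`-boundary expander with `r ≥ 1 + ℓ + ℓ²`,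
  then EVERY nonempty index set (of any size) has a boundary point. Proof (two-step partner
  argument): if `∂F = ∅`, pick `a ∈ F`, one partner row `g v ∈ F ∖ {a}` through each point `v` of
  `S a` (`B₁`, `I₁ = {a} ∪ B₁`), then one partner row `h w ∈ F ∖ I₁` through each boundary point `w`
  of `I₁` (`B₂`, `I₂ = I₁ ∪ B₂`, `|I₂| ≤ 1 + ℓ + ℓ² ≤ r`). Every point covered by `I₁` is covered
  twice by `I₂`, so `∂I₂` consists of points of rows of `B₂` outside `cover I₁`, at most `ℓ - 1`
  per row: `(3ℓ/4)(|I₁| + |B₂|) ≤ (ℓ - 1)|B₂|`, i.e. `(3ℓ/4)|I₁| ≤ (ℓ/4 - 1)|B₂|`; with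
  `|B₂| ≤ |∂I₁| ≤ ℓ|B₁| < ℓ|I₁|` this forces `3ℓ/4 < (ℓ/4 - 1)ℓ`, i.e. `ℓ > 7`.
* `exists_rows_hold_of_forall_boundary_nonempty` — peeling (Ben-Sasson–Wigderson flips, already
  in the tree as `exists_flip_row`) under the hereditary hypothesis "every nonempty subset has a
  boundary point": all rows of `I` have a common solution.
* `systemSat_of_isBoundaryExpander_of_le_seven` — hence such systems are solvable.
* `expansionForcesDepthFregeSize_of_le_seven` — the item's statement with its leading
  `∀ ℓ` restricted to `1 ≤ ℓ ≤ 7` (take `ε = 1`, `R = 1 + ℓ + ℓ²`; the unsolvability hypothesis is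
  contradictory).

What is NOT here: `ℓ ≥ 8`. At `ℓ = 8` boundaryless expanding configurations exist but (Tseitin
systems of 8-regular graphs of girth `> r`) seem to need `2^{Ω(r)}` rows; from `ℓ = 9` on,
linear-size unsolvable `(r, 3ℓ/4)`-expanders exist (Tseitin systems of random `ℓ`-regular graphs on
`Θ(r)` vertices, random LDPC-type systems), and there the item is a genuine bounded-depth Frege
lower bound (open beyond column weight 2; it implies Krajíček's Problem 19.4.5 through the proved
glue `ExpansionGivesLinearGeneratorHard`).

References: E. Ben-Sasson, A. Wigderson, *Short proofs are narrow — resolution made simple*,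
J. ACM 48 (2001), §5 (boundary, flips) [BenSassonWigderson2001]; J. Krajíček, *Proof Complexity*
(CUP 2019), §13.3 (`(r, 3/4)`-expanders) [KrajicekProofComplexity2019].
-/

namespace Summit.PneNP.PneNP.Theorems

set_option linter.dupNamespace false -- `Summit.PneNP.PneNP.…`: summit = sub-problem (D-0017)

open Finset Literature.Computability.MetaComplexity Literature.Computability.Complexity

section Combinatorics

variable {ι : Type*} [DecidableEq ι] {S : ι → Finset ℕ}

/-- In an index set `F` with EMPTY boundary, every point of a scope `S i`, `i ∈ F`, lies in a second
scope `S j`, `j ∈ F`, `j ≠ i` (its cover degree is not `1`, hence `≥ 2`). [folklore] -/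
theorem exists_partner_of_boundary_eq_empty {F : Finset ι} (hbd : boundary S F = ∅) {i : ι}
    (hi : i ∈ F) {v : ℕ} (hv : v ∈ S i) : ∃ j ∈ F, j ≠ i ∧ v ∈ S j := by
  have hvc : v ∈ cover S F := subset_cover hi hv
  have hdeg : coverDegree S F v ≠ 1 := fun h1 => by
    have : v ∈ boundary S F := mem_boundary.2 ⟨hvc, h1⟩
    simp [hbd] at this
  have h1 : 1 ≤ coverDegree S F v := one_le_coverDegree hvc
  have h2 : 1 < (F.filter fun j => v ∈ S j).card := by
    unfold coverDegree at hdeg h1; omega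
  obtain ⟨j, hj, hji⟩ := Finset.exists_mem_ne h2 i
  rw [Finset.mem_filter] at hj
  exact ⟨j, hj.1, hji, hj.2⟩

omit [DecidableEq ι] in
/-- The cover of a family is at most the total size of its scopes. [folklore] -/
theorem card_cover_le_mul {ℓ : ℕ} (hS : ∀ i, (S i).card ≤ ℓ) (F : Finset ι) :
    (cover S F).card ≤ ℓ * F.card := by
  calc (cover S F).card ≤ ∑ i ∈ F, (S i).card := Finset.card_biUnion_le
    _ ≤ ∑ _i ∈ F, ℓ := Finset.sum_le_sum fun i _ => hS i
    _ = ℓ * F.card := by rw [Finset.sum_const, smul_eq_mul, mul_comm]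

/-- **No boundaryless row sets at locality `ℓ ≤ 7`.** If every scope has at most `ℓ` points,
`1 ≤ ℓ ≤ 7`, and the scopes form an `(r, 3/4 · ℓ)`-boundary expander with `r ≥ 1 + ℓ + ℓ²`, then
every nonempty index set — of any cardinality — has a boundary (unique-neighbour) point.
Two-step partner argument, see the module docstring. [folklore] -/
theorem boundary_nonempty_of_isBoundaryExpander_of_le_seven {ℓ : ℕ} (hℓ1 : 1 ≤ ℓ) (hℓ7 : ℓ ≤ 7)
    (hS : ∀ i, (S i).card ≤ ℓ) {r : ℝ} (hr : (1 + ℓ + ℓ ^ 2 : ℝ) ≤ r)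
    (hexp : IsBoundaryExpander S r (3 / 4 * ℓ)) {F : Finset ι} (hF : F.Nonempty) :
    (boundary S F).Nonempty := by
  by_contra hcon
  have hbd : boundary S F = ∅ := Finset.not_nonempty_iff_eq_empty.1 hcon
  obtain ⟨a, ha⟩ := hF
  -- Step 1: one partner row through each point of `S a`.
  have hex1 : ∀ v : ℕ, ∃ j : ι, v ∈ S a → (j ∈ F ∧ j ≠ a ∧ v ∈ S j) := by
    intro v
    by_cases hv : v ∈ S a
    · obtain ⟨j, hj, hja, hvj⟩ := exists_partner_of_boundary_eq_empty hbd ha hv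
      exact ⟨j, fun _ => ⟨hj, hja, hvj⟩⟩
    · exact ⟨a, fun h => absurd h hv⟩
  choose g hg using hex1
  set B₁ : Finset ι := (S a).image g with hB₁
  set I₁ : Finset ι := insert a B₁ with hI₁
  have hB₁F : B₁ ⊆ F := by
    intro j hj
    obtain ⟨v, hv, rfl⟩ := Finset.mem_image.1 hj
    exact (hg v hv).1
  have haB₁ : a ∉ B₁ := by
    intro h
    obtain ⟨v, hv, hva⟩ := Finset.mem_image.1 h
    exact (hg v hv).2.1 hva
  have hI₁F : I₁ ⊆ F := Finset.insert_subset ha hB₁F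
  have hI₁card : I₁.card = B₁.card + 1 := Finset.card_insert_of_notMem haB₁
  have hB₁card : B₁.card ≤ ℓ := Finset.card_image_le.trans (hS a)
  -- every point of `S a` is covered at least twice by `I₁`, so `∂I₁ ⊆ cover B₁`
  have hSa_two : ∀ v ∈ S a, ∀ J : Finset ι, I₁ ⊆ J → v ∉ boundary S J := by
    intro v hv J hJ hvJ
    obtain ⟨i, ⟨-, -⟩, huniq⟩ := existsUnique_of_mem_boundary hvJ
    have h1 : a = i := huniq a ⟨hJ (Finset.mem_insert_self a B₁), hv⟩
    have h2 : g v = i :=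
      huniq (g v) ⟨hJ (Finset.mem_insert_of_mem (Finset.mem_image_of_mem g hv)), (hg v hv).2.2⟩
    exact (hg v hv).2.1 (h2.trans h1.symm)
  have hbdI₁ : boundary S I₁ ⊆ cover S B₁ := by
    intro w hw
    have hwc : w ∈ cover S I₁ := boundary_subset_cover _ hw
    rw [hI₁, ← Finset.cons_eq_insert a B₁ haB₁] at hwc
    simp only [cover, Finset.cons_eq_insert, Finset.biUnion_insert, Finset.mem_union] at hwc
    rcases hwc with hwa | hwB
    · exact absurd hw (hSa_two w hwa I₁ le_rfl)
    · exact hwB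
  have hbdI₁card : (boundary S I₁).card ≤ ℓ * B₁.card :=
    (Finset.card_le_card hbdI₁).trans (card_cover_le_mul hS B₁)
  -- Step 2: one partner row OUTSIDE `I₁` through each boundary point of `I₁`.
  have hex2 : ∀ w : ℕ, ∃ j : ι, w ∈ boundary S I₁ → (j ∈ F ∧ j ∉ I₁ ∧ w ∈ S j) := by
    intro w
    by_cases hw : w ∈ boundary S I₁
    · obtain ⟨i, ⟨hiI, hwi⟩, huniq⟩ := existsUnique_of_mem_boundary hw
      obtain ⟨j, hjF, hji, hwj⟩ := exists_partner_of_boundary_eq_empty hbd (hI₁F hiI) hwi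
      refine ⟨j, fun _ => ⟨hjF, fun hjI => hji (huniq j ⟨hjI, hwj⟩), hwj⟩⟩
    · exact ⟨a, fun h => absurd h hw⟩
  choose h hh using hex2
  set B₂ : Finset ι := (boundary S I₁).image h with hB₂
  set I₂ : Finset ι := I₁ ∪ B₂ with hI₂
  have hdisj : Disjoint I₁ B₂ := by
    rw [Finset.disjoint_right]
    intro j hj
    obtain ⟨w, hw, rfl⟩ := Finset.mem_image.1 hj
    exact (hh w hw).2.1
  have hI₂card : I₂.card = I₁.card + B₂.card := Finset.card_union_of_disjoint hdisj
  have hB₂card : B₂.card ≤ (boundary S I₁).card := Finset.card_image_le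
  -- `|I₂| ≤ 1 + ℓ + ℓ² ≤ r`
  have hI₂le : (I₂.card : ℝ) ≤ r := by
    have h1 : B₂.card ≤ ℓ * ℓ :=
      hB₂card.trans (hbdI₁card.trans (Nat.mul_le_mul_left ℓ hB₁card))
    have h2 : I₂.card ≤ 1 + ℓ + ℓ ^ 2 := by rw [hI₂card, hI₁card, sq]; omega
    have h3 : (I₂.card : ℝ) ≤ (1 + ℓ + ℓ ^ 2 : ℕ) := by exact_mod_cast h2
    push_cast at h3
    exact h3.trans hr
  -- every point covered by `I₁` is covered at least twice by `I₂`
  have hbdI₂ : boundary S I₂ ⊆ B₂.biUnion fun j => S j \ cover S I₁ := by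
    intro v hv
    obtain ⟨i, ⟨hiI₂, hvi⟩, huniq⟩ := existsUnique_of_mem_boundary hv
    have hvI₁ : v ∉ cover S I₁ := by
      intro hvc
      by_cases hvb : v ∈ boundary S I₁
      · -- `v` is a boundary point of `I₁`: its `I₁`-row and `h v` are two rows of `I₂` through `v`
        obtain ⟨i₀, ⟨hi₀I, hvi₀⟩, -⟩ := existsUnique_of_mem_boundary hvb
        have e1 : i₀ = i := huniq i₀ ⟨Finset.mem_union_left _ hi₀I, hvi₀⟩
        have e2 : h v = i :=
          huniq (h v) ⟨Finset.mem_union_right _ (Finset.mem_image_of_mem h hvb), (hh v hvb).2.2⟩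
        exact (hh v hvb).2.1 (e2.trans e1.symm ▸ hi₀I)
      · -- `v` has cover degree `≥ 2` in `I₁` already
        have hdeg : coverDegree S I₁ v ≠ 1 := fun h1 => hvb (mem_boundary.2 ⟨hvc, h1⟩)
        have h1 : 1 ≤ coverDegree S I₁ v := one_le_coverDegree hvc
        have h2 : 1 < (I₁.filter fun j => v ∈ S j).card := by
          unfold coverDegree at hdeg h1; omega
        obtain ⟨j, hj, hji⟩ := Finset.exists_mem_ne h2 i
        rw [Finset.mem_filter] at hj
        exact hji (huniq j ⟨Finset.mem_union_left _ hj.1, hj.2⟩)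
    have hiB₂ : i ∈ B₂ := by
      rcases Finset.mem_union.1 hiI₂ with hiI₁ | hiB₂
      · exact absurd (subset_cover hiI₁ hvi) hvI₁
      · exact hiB₂
    exact Finset.mem_biUnion.2 ⟨i, hiB₂, Finset.mem_sdiff.2 ⟨hvi, hvI₁⟩⟩
  -- each row of `B₂` meets `cover I₁`, so contributes at most `ℓ - 1` boundary points
  have hrow : ∀ j ∈ B₂, (S j \ cover S I₁).card + 1 ≤ ℓ := by
    intro j hj
    obtain ⟨w, hw, rfl⟩ := Finset.mem_image.1 hj
    have hwS : w ∈ S (h w) := (hh w hw).2.2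
    have hwc : w ∈ cover S I₁ := boundary_subset_cover _ hw
    have hlt : (S (h w) \ cover S I₁).card < (S (h w)).card :=
      Finset.card_lt_card ⟨Finset.sdiff_subset, fun hsub =>
        (Finset.mem_sdiff.1 (hsub hwS)).2 hwc⟩
    have := hS (h w)
    omega
  have hbdI₂card : (boundary S I₂).card + B₂.card ≤ ℓ * B₂.card := by
    have h1 : (boundary S I₂).card ≤ ∑ j ∈ B₂, (S j \ cover S I₁).card :=
      (Finset.card_le_card hbdI₂).trans Finset.card_biUnion_le
    have h2 : ∑ j ∈ B₂, ((S j \ cover S I₁).card + 1) ≤ ∑ _j ∈ B₂, ℓ :=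
      Finset.sum_le_sum hrow
    rw [Finset.sum_add_distrib, Finset.sum_const, Finset.sum_const, smul_eq_mul, smul_eq_mul,
      mul_one, mul_comm] at h2
    omega
  -- expansion at `I₂` and the final count
  have hexp₂ := hexp I₂ hI₂le
  have eI₂ : (I₂.card : ℝ) = B₁.card + 1 + B₂.card := by
    rw [hI₂card, hI₁card]; push_cast; ring
  have e1 : ((boundary S I₂).card : ℝ) + B₂.card ≤ ℓ * B₂.card := by exact_mod_cast hbdI₂card
  have e2 : (B₂.card : ℝ) ≤ ℓ * B₁.card := by exact_mod_cast hB₂card.trans hbdI₁card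
  have hℓ1' : (1 : ℝ) ≤ ℓ := by exact_mod_cast hℓ1
  have hℓ7' : (ℓ : ℝ) ≤ 7 := by exact_mod_cast hℓ7
  have hb₁ : (0 : ℝ) ≤ B₁.card := Nat.cast_nonneg _
  have hb₂ : (0 : ℝ) ≤ B₂.card := Nat.cast_nonneg _
  rw [eI₂] at hexp₂
  have e3 : (0 : ℝ) ≤ (7 - ℓ) * B₂.card := mul_nonneg (by linarith) hb₂
  nlinarith [e1, e2, e3, hexp₂, mul_nonneg (by linarith : (0 : ℝ) ≤ ℓ) hb₁]

end Combinatorics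

/-- **Peeling under a hereditary boundary hypothesis** (Ben-Sasson–Wigderson flips, row level):
if every nonempty subset of a set `I` of rows of a system over `𝔽₂` has a boundary variable, then
all rows of `I` have a common solution (induct: remove the row owning a boundary variable, solve
the rest, flip that variable if needed — `exists_flip_row`).
[BenSassonWigderson2001, Lemma 5.7 / Thm 6.5] [folklore] -/
theorem exists_rows_hold_of_forall_boundary_nonempty {n m : ℕ} (E : Fin m → LinEqMod 2 n)
    (I : Finset (Fin m))
    (hI : ∀ J ⊆ I, J.Nonempty →
      (boundary (fun i => (E i).supp.map Fin.valEmbedding) J).Nonempty) :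
    ∃ σ : ℕ → Bool, ∀ i ∈ I, (E i).Holds (blockVals 2 1 n σ) := by
  induction I using Finset.strongInduction with
  | H I ih =>
    rcases I.eq_empty_or_nonempty with rfl | hne
    · exact ⟨fun _ => false, by simp⟩
    obtain ⟨x, hx⟩ := hI I subset_rfl hne
    obtain ⟨i, hi, j, rfl, hji, huniq⟩ := exists_unique_row_of_mem_boundary E hx
    obtain ⟨σ, hσ⟩ := ih (I.erase i) (Finset.erase_ssubset hi)
      (fun J hJ hJne => hI J (hJ.trans (Finset.erase_subset _ _)) hJne)
    obtain ⟨b, hb, -⟩ := exists_flip_row E hji huniq hσ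
    exact ⟨_, hb⟩

/-- **Expanding `ℓ`-sparse systems with `ℓ ≤ 7` are solvable.** If the rows of a system over `𝔽₂`
have supports of size `≤ ℓ`, `1 ≤ ℓ ≤ 7`, forming an `(r, 3/4 · ℓ)`-boundary expander with
`r ≥ 1 + ℓ + ℓ²`, then the whole system has a solution: every nonempty row set has a boundary
variable (`boundary_nonempty_of_isBoundaryExpander_of_le_seven`), so the system peels. [folklore] -/
theorem systemSat_of_isBoundaryExpander_of_le_seven {ℓ n m : ℕ} (E : Fin m → LinEqMod 2 n)
    (hℓ1 : 1 ≤ ℓ) (hℓ7 : ℓ ≤ 7) (hsparse : ∀ i, (E i).supp.card ≤ ℓ) {r : ℝ}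
    (hr : (1 + ℓ + ℓ ^ 2 : ℝ) ≤ r)
    (hexp : IsBoundaryExpander (fun i => (E i).supp.map Fin.valEmbedding) r (3 / 4 * ℓ)) :
    SystemSat E Finset.univ := by
  have hS : ∀ i, ((fun i => (E i).supp.map Fin.valEmbedding) i).card ≤ ℓ := fun i => by
    simpa using hsparse i
  obtain ⟨σ, hσ⟩ := exists_rows_hold_of_forall_boundary_nonempty E Finset.univ
    (fun J _ hJ => boundary_nonempty_of_isBoundaryExpander_of_le_seven hℓ1 hℓ7 hS hr hexp hJ)
  exact ⟨blockVals 2 1 n σ, fun i hi => hσ i hi⟩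

/-- **The expansion-scale law at locality `ℓ ≤ 7`** (item stmt-PneNP-11442,
`ExpansionForcesDepthFregeSize`, with its leading `∀ ℓ` restricted to `1 ≤ ℓ ≤ 7`): with `ε = 1`
and `R = 1 + ℓ + ℓ²` the statement holds because its hypotheses are contradictory — an `ℓ`-sparse
`(r, 3/4 · ℓ)`-boundary-expanding system with `ℓ ≤ 7`, `r ≥ R` is solvable
(`systemSat_of_isBoundaryExpander_of_le_seven`). [folklore] -/
theorem expansionForcesDepthFregeSize_of_le_seven (ℓ d : ℕ) (hℓ1 : 1 ≤ ℓ) (hℓ7 : ℓ ≤ 7) :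
    ∃ ε : ℝ, 0 < ε ∧ ∃ R : ℝ, ∀ r : ℝ, R ≤ r → ∀ (n m : ℕ) (E : Fin m → LinEqMod 2 n),
      (∀ i, (E i).supp.card ≤ ℓ) →
      IsBoundaryExpander (fun i => (E i).supp.map Fin.valEmbedding) r (3 / 4 * ℓ) →
      ¬ SystemSat E Finset.univ →
      ∀ π : List (PropForm ℕ), textbookFrege.IsDepthProofOf d π
        (PropForm.neg (PropForm.ofCNF (sumEncoding 1 E))) →
      (2 : ℝ) ^ (r ^ ε) ≤ (proofSize π : ℝ) :=
  ⟨1, one_pos, 1 + ℓ + ℓ ^ 2, fun _r hr _n _m E hsparse hexp hunsat _π _hπ =>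
    absurd (systemSat_of_isBoundaryExpander_of_le_seven E hℓ1 hℓ7 hsparse hr hexp) hunsat⟩

end Summit.PneNP.PneNP.Theorems
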